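import Summits.NavierStokesRegularity.NavierStokesRegularity.Theorems.BoundedTemperatureClosed.Negative.CollinearBites
import Literature.Analysis.FluidPDE.TaoCascadeDuhamel

/-!
# Crux `BoundedTemperatureClosed` (stmt-NavierStokesRegularity-18303) — strategist, negation lens (N3):
# a conditional kill from a PUMP-DESIGN hypothesis, with no Navier–Stokes input

STRATEGY-CENSUS §6 N3, kernel-checked. Every conditional refutation of the crux on file passes through
a Navier–Stokes blow-up (`H := TypeIInfimumNotAttainedNS → ¬ crux`, p146867). This file lands the first
one that does not: `not_boundedTemperatureClosed_of_transparentPump`.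

Observation. Tao's mild formulation (1.15) sees the form `T` only through `s ↦ T(u s, u s, ·)` along
the trajectory (`isMildSolutionFor_of_congr_traj`). Call a trajectory *Euler-transparent* on `[0,S)` if
`⟨B(u t, u t), w⟩ = 0` for every `w ∈ H¹⁰_df` and every `t ∈ [0,S)` — i.e. `u t` is a weak STEADY EULER
field at every instant (smooth compactly supported steady Euler fields on `ℝ³` exist, Gavrilov 2019, and
form a cone invariant under scaling, rotation and translation, so self-similar-type curves through such a
profile are transparent Schwartz-valued trajectories; whether an averaged pump can drive one to blow-up is
the design problem named below).

Hypothesis `TransparentPumpNonAttainment` (registered open, `@[conjecture]`): some symmetric cancelling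
averaging datum `Pd` (a "pump") and a temperature `K* > 0` admit, at every ceiling `K > K*`, an
Euler-transparent Schwartz-data `H¹⁰_df`-mild Type-I blow-up (no mild extension), but NO Schwartz-data
Type-I blow-up at the ceiling `K*` itself (transparent or not): the infimal transparent temperature of the
pump is not attained.

Conclusion: the crux fails at the datum `𝒟` with `B̃_𝒟 = 2B̃_Pd − B` on `H¹⁰_df` (the segment datum of
`Pd` at the real parameter `θ₀ = −1`, `exists_datum_form_eq_seg_symm_canc`) and the ceiling `K*`: the
segment of `𝒟` is `T_θ = 2(1−θ)B̃_Pd + (2θ−1)B`; a transparent pump witness of temperature `2(1−θ)K* > K*`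
rescaled by `u ↦ u/(2(1−θ))` is a witness of `T_θ` at ceiling exactly `K*` for every `θ ∈ [0, 1/2)`
(the `(2θ−1)B` term is invisible to it; non-extension transfers through the `H¹⁰` continuation criterion
of the pump, `stub_thesis_H10Continuation`, because an extension would bound the `H¹⁰` norm on `[0,S]`,
`ContinuousInH10On.exists_bound`), while `θ = 1/2`, where `T_{1/2} = B̃_Pd` on `H¹⁰_df`, is NOT a member
by the non-attainment clause. So `[0,1/2) ⊆ S_{𝒟,K*} ∌ 1/2` and `S_{𝒟,K*}` is not closed.

Status of the hypothesis (census §6): open, design-grade, no approach — certifying "no witness at `K*`"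
needs `K*` to be the pump's PROVABLE temperature floor, hence transparent blow-up trajectories that nearly
saturate every inequality of the `L^∞` local-existence argument at every instant (the NLH mechanism, whose
saturator is the spatially constant ODE solution); a translation-invariant multiplier-defined vector form
has no maximum principle and no candidate saturator. The value of the lemma is to relocate an
unconditional kill from Navier–Stokes blow-up to pump design + steady-Euler transparency.

## References

* T. Tao, J. Amer. Math. Soc. 29 (2016), arXiv:1402.0290v3, §1.1 (1.13), (1.15), §3.1–§3.2. [`Tao2016AveragedNS`]
* A. V. Gavrilov, A steady Euler flow with compact support, Geom. Funct. Anal. 29 (2019) 190–197,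
  doi:10.1007/s00039-019-00476-6. [graph:doi:10.1007/s00039-019-00476-6]
* P. Constantin, J. La, V. Vicol, Remarks on a paper by Gavrilov, arXiv:1903.11699, p. 11. [corpus:paper:arxiv-1903.11699]
-/

noncomputable section

-- the nested summit namespace `…NavierStokesRegularity.NavierStokesRegularity…` is the tree's layout (D-0017)
set_option linter.dupNamespace false

namespace Summit.NavierStokesRegularity.NavierStokesRegularity.Cruxes.BoundedTemperatureClosed.StrategistNegation

open MeasureTheory Set Filter Topology
open scoped ENNReal
open Literature.Analysis.FluidPDE Literature.Analysis.FluidPDE.Tao2016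
open Literature.Analysis.FunctionSpaces (eFourierSobolevNorm)
open Summit.NavierStokesRegularity.NavierStokesRegularity.Theses.PumpContinuation
open Summit.NavierStokesRegularity.NavierStokesRegularity.Theorems.BoundedTemperatureClosed.Negative
open Summit.NavierStokesRegularity.NavierStokesRegularity.Theorems.PumpContinuationEulerProximatePump
  (isMildSolutionFor_smul inv_smul_smul_ofReal)
open Summit.NavierStokesRegularity.NavierStokesRegularity.Theorems.PerpetualPumpEulerTypeIGlue
  (eLpNorm_coe_const_smul isDivFree_const_smul eFourierSobolevNorm_const_smul)
open Summit.NavierStokesRegularity.NavierStokesRegularity.Theorems.PumpContinuationSegmentAveraged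
  (isMildSolutionFor_Ico_congr_memH10df exists_datum_form_eq_seg_symm_canc uIcc_subset_Ico)
open Summit.NavierStokesRegularity.NavierStokesRegularity.Theorems.PerpetualPumpThesis
  (stub_thesis_H10Continuation)
open Summit.NavierStokesRegularity.NavierStokesRegularity.Theorems.PerpetualPumpThesis.B
  (form_smul₁ form_smul₂)

/-- The bounded-temperature blow-up set of the datum `𝒜` at ceiling `M` along the segment
`T_θ = (1-θ)·B̃_𝒜 + θ·B` — verbatim the set whose closedness the crux asserts. -/
local notation3 "btSet[" 𝒜 ", " M "]" =>
  {θ : ℝ | θ ∈ Set.Icc (0 : ℝ) 1 ∧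
    ∃ u₀ : SchwartzMap (EuclideanSpace ℝ (Fin 3)) (EuclideanSpace ℝ (Fin 3)),
      Literature.Analysis.FluidPDE.VectorCalculus.IsDivFree ⇑u₀ ∧ ∃ S : ℝ, 0 < S ∧
      ∃ u : ℝ → Literature.Analysis.FluidPDE.Tao2016.L2C,
        Literature.Analysis.FluidPDE.Tao2016.IsMildSolutionFor
          (fun a b c => ((1 - θ : ℝ) : ℂ) * AveragingDatum.form 𝒜 a b c +
            ((θ : ℝ) : ℂ) * Literature.Analysis.FluidPDE.Tao2016.eulerForm a b c)
          (Literature.Analysis.FluidPDE.Tao2016.schwartzL2 u₀) (Set.Ico 0 S) u ∧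
        (∀ t ∈ Set.Ico 0 S, MeasureTheory.eLpNorm (u t) ⊤ MeasureTheory.volume ≤
          ENNReal.ofReal (M / Real.sqrt (S - t))) ∧
        ¬ ∃ S' : ℝ, S < S' ∧ ∃ v : ℝ → Literature.Analysis.FluidPDE.Tao2016.L2C,
          Literature.Analysis.FluidPDE.Tao2016.IsMildSolutionFor
            (fun a b c => ((1 - θ : ℝ) : ℂ) * AveragingDatum.form 𝒜 a b c +
              ((θ : ℝ) : ℂ) * Literature.Analysis.FluidPDE.Tao2016.eulerForm a b c)
            (Literature.Analysis.FluidPDE.Tao2016.schwartzL2 u₀) (Set.Ico 0 S') v ∧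
          ∀ t ∈ Set.Ico 0 S, v t = u t}

/-- **Schwartz-data `H¹⁰_df`-mild Type-I witness of the pump `Pd` at ceiling `K`** (datum, blow-up time,
curve: mild for `B̃_Pd`, Type-I rate `K`, no mild extension). -/
local notation3 "pumpTypeI[" Pd ", " K "]" =>
  ∃ u₀ : SchwartzMap (EuclideanSpace ℝ (Fin 3)) (EuclideanSpace ℝ (Fin 3)),
    Literature.Analysis.FluidPDE.VectorCalculus.IsDivFree ⇑u₀ ∧ ∃ S : ℝ, 0 < S ∧
    ∃ u : ℝ → Literature.Analysis.FluidPDE.Tao2016.L2C,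
      Literature.Analysis.FluidPDE.Tao2016.IsMildSolutionFor (AveragingDatum.form Pd)
        (Literature.Analysis.FluidPDE.Tao2016.schwartzL2 u₀) (Set.Ico 0 S) u ∧
      (∀ t ∈ Set.Ico 0 S, MeasureTheory.eLpNorm (u t) ⊤ MeasureTheory.volume ≤
        ENNReal.ofReal (K / Real.sqrt (S - t))) ∧
      ¬ ∃ S' : ℝ, S < S' ∧ ∃ v : ℝ → Literature.Analysis.FluidPDE.Tao2016.L2C,
        Literature.Analysis.FluidPDE.Tao2016.IsMildSolutionFor (AveragingDatum.form Pd)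
          (Literature.Analysis.FluidPDE.Tao2016.schwartzL2 u₀) (Set.Ico 0 S') v ∧
        ∀ t ∈ Set.Ico 0 S, v t = u t

/-- **… and an Euler-TRANSPARENT one**: the same, with `⟨B(u t, u t), w⟩ = 0` for all `w ∈ H¹⁰_df`,
`t ∈ [0,S)` (the curve is a weak steady Euler field at every instant). -/
local notation3 "pumpTypeITransparent[" Pd ", " K "]" =>
  ∃ u₀ : SchwartzMap (EuclideanSpace ℝ (Fin 3)) (EuclideanSpace ℝ (Fin 3)),
    Literature.Analysis.FluidPDE.VectorCalculus.IsDivFree ⇑u₀ ∧ ∃ S : ℝ, 0 < S ∧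
    ∃ u : ℝ → Literature.Analysis.FluidPDE.Tao2016.L2C,
      Literature.Analysis.FluidPDE.Tao2016.IsMildSolutionFor (AveragingDatum.form Pd)
        (Literature.Analysis.FluidPDE.Tao2016.schwartzL2 u₀) (Set.Ico 0 S) u ∧
      (∀ t ∈ Set.Ico 0 S, MeasureTheory.eLpNorm (u t) ⊤ MeasureTheory.volume ≤
        ENNReal.ofReal (K / Real.sqrt (S - t))) ∧
      (¬ ∃ S' : ℝ, S < S' ∧ ∃ v : ℝ → Literature.Analysis.FluidPDE.Tao2016.L2C,
        Literature.Analysis.FluidPDE.Tao2016.IsMildSolutionFor (AveragingDatum.form Pd)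
          (Literature.Analysis.FluidPDE.Tao2016.schwartzL2 u₀) (Set.Ico 0 S') v ∧
        ∀ t ∈ Set.Ico 0 S, v t = u t) ∧
      ∀ t ∈ Set.Ico 0 S, ∀ w : Literature.Analysis.FluidPDE.Tao2016.L2C,
        Literature.Analysis.FluidPDE.Tao2016.MemH10df w →
          Literature.Analysis.FluidPDE.Tao2016.eulerForm (u t) (u t) w = 0

/-! ### The pump-design hypothesis -/

/-- OPEN STATEMENT — **a pump whose infimal transparent temperature is not attained.** Some symmetric
cancelling averaging datum `Pd` and some `K* > 0` admit Euler-transparent Schwartz-data `H¹⁰_df`-mild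
Type-I blow-ups at every ceiling `K > K*`, but no Schwartz-data Type-I blow-up of `B̃_Pd` at ceiling `K*`.
A CONSTRUCTION problem in Tao's averaged class (design-grade; STRATEGY-CENSUS §6 N3 explains why no
technology certifies the non-attainment clause: it needs a sharp temperature floor for a designed form).
Users take `(h : TransparentPumpNonAttainment)` as an explicit hypothesis. [status: open]
[topic Analysis/FluidPDE] [cite: Tao2016AveragedNS, §1.1 (1.15)] -/
@[conjecture] def TransparentPumpNonAttainment : Prop :=
  ∃ Pd : AveragingDatum, Pd.IsSymmetric ∧ Pd.HasCancellation ∧ ∃ Kstar : ℝ, 0 < Kstar ∧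
    (∀ K : ℝ, Kstar < K → pumpTypeITransparent[Pd, K]) ∧ ¬ pumpTypeI[Pd, Kstar]

/-! ### Two tools: trajectory congruence and the `H¹⁰` bound of an extension -/

/-- **Trajectory congruence of the mild formulation.** Two forms that agree ALONG THE TRAJECTORY
(`T(u s, u s, w) = T'(u s, u s, w)` for `s ∈ [0,S)`, `w ∈ H¹⁰_df`) have `u` as a common mild solution on
`[0,S)`: (1.15) only integrates `s ↦ T(u s, u s, e^{(t-s)Δ}w)` over `[0,t] ⊆ [0,S)`. [cite: Tao2016AveragedNS, §1.1 (1.15)] -/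
theorem isMildSolutionFor_of_congr_traj {T T' : L2C → L2C → L2C → ℂ} {a : L2C} {S : ℝ} {u : ℝ → L2C}
    (hu : IsMildSolutionFor T a (Ico 0 S) u)
    (h : ∀ s ∈ Ico (0 : ℝ) S, ∀ w : L2C, MemH10df w → T (u s) (u s) w = T' (u s) (u s) w) :
    IsMildSolutionFor T' a (Ico 0 S) u := by
  refine ⟨hu.1, hu.2.1, fun t ht w hw => ?_⟩
  rw [hu.2.2 t ht w hw]
  congr 1
  refine intervalIntegral.integral_congr fun s hs => ?_
  exact h s (uIcc_subset_Ico ht hs) _ (hw.heat _)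

/-- **A mild extension bounds the `H¹⁰` norm on the old interval.** If `v` is a mild solution on `[0,S')`
with `S < S'`, then `‖v t‖_{H¹⁰}` is bounded on `[0,S)` (continuity in `H¹⁰` on the compact `[0,S]`,
`ContinuousInH10On.exists_bound`). [cite: Tao2016AveragedNS, Lemma 4.1 (4.6)] -/
theorem exists_H10_bound_of_extension {T : L2C → L2C → L2C → ℂ} {a : L2C} {S S' : ℝ} (hSS' : S < S')
    {v : ℝ → L2C} (hv : IsMildSolutionFor T a (Ico 0 S') v) :
    ∃ C : ℝ, ∀ t ∈ Ico (0 : ℝ) S, eFourierSobolevNorm 10 (v t) ≤ ENNReal.ofReal C := by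
  have hsub : Icc (0 : ℝ) S ⊆ Ico 0 S' := fun t ht => ⟨ht.1, ht.2.trans_lt hSS'⟩
  have hcont : ContinuousInH10On (Icc 0 S) v := fun t₀ ht₀ =>
    (hv.2.1 t₀ (hsub ht₀)).mono_left (nhdsWithin_mono _ hsub)
  obtain ⟨M, hM⟩ := ContinuousInH10On.exists_bound hcont fun t ht => (hv.1 t (hsub ht)).1
  refine ⟨M, fun t ht => ?_⟩
  rw [← ENNReal.ofReal_toReal (hv.1 t ⟨ht.1, ht.2.trans hSS'⟩).1.ne]
  exact ENNReal.ofReal_le_ofReal (hM t ⟨ht.1, ht.2.le⟩)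

/-! ### The bite -/

/-- **Negative lemma (negation lens N3): `TransparentPumpNonAttainment → ¬ BoundedTemperatureClosed`.**
At the datum `𝒟` with `B̃_𝒟 = 2B̃_Pd − B` on `H¹⁰_df` and the ceiling `K*`: `[0, 1/2) ⊆ S_{𝒟,K*}`
(rescaled transparent pump witnesses; the Euler component `(2θ−1)B` of `T_θ` vanishes along them) and
`1/2 ∉ S_{𝒟,K*}` (`T_{1/2} = B̃_Pd` on `H¹⁰_df`; non-attainment), so `S_{𝒟,K*}` is not closed. No
Navier–Stokes input. [cite: Tao2016AveragedNS, §1.1 (1.15)] -/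
theorem not_boundedTemperatureClosed_of_transparentPump (h : TransparentPumpNonAttainment) :
    ¬ BoundedTemperatureClosed := by
  intro hC
  obtain ⟨Pd, hPs, hPc, K, hK, hfam, hnone⟩ := h
  -- the datum `𝒟` with form `2·B̃_Pd − B` on `H¹⁰_df`: the segment datum of `Pd` at `θ₀ = -1`
  obtain ⟨𝒟, h𝒟, h𝒟s, h𝒟c⟩ := exists_datum_form_eq_seg_symm_canc Pd (-1)
  have hcl := hC 𝒟 (h𝒟s hPs) (h𝒟c hPc) K
  -- Step 1: every `θ ∈ [0, 1/2)` is a member at ceiling `K`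
  have hsub : Ico (0 : ℝ) (1 / 2) ⊆ btSet[𝒟, K] := by
    intro θ hθ
    have h1θ : 0 < 1 - θ := by linarith [hθ.2]
    have hKθ : K < 2 * (1 - θ) * K := by nlinarith [hθ.2, hK]
    obtain ⟨u₀, hdiv, S, hS, u, hu, hrate, hnoext, htr⟩ := hfam _ hKθ
    -- the rescaling factor `c = 1/(2(1-θ))`
    obtain ⟨c, hcdef⟩ : ∃ c : ℝ, c = 1 / (2 * (1 - θ)) := ⟨_, rfl⟩
    have hc : 0 < c := by rw [hcdef]; positivity
    have hc0 : c ≠ 0 := hc.ne'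
    have hc2 : 2 * (1 - θ) * c = 1 := by rw [hcdef]; field_simp
    have hcK : c * (2 * (1 - θ) * K) = K := by
      calc c * (2 * (1 - θ) * K) = (2 * (1 - θ) * c) * K := by ring
        _ = K := by rw [hc2, one_mul]
    -- `c • u` is a mild solution of the rescaled pump `2(1-θ)·B̃_Pd`
    have hG : ∀ a b w : L2C, ((2 * (1 - θ) : ℝ) : ℂ) * Pd.form (((c : ℝ) : ℂ) • a) (((c : ℝ) : ℂ) • b) w =
        ((c : ℝ) : ℂ) * Pd.form a b w := by
      intro a b w
      have hAc : ((2 * (1 - θ) : ℝ) : ℂ) * ((c : ℝ) : ℂ) = 1 := by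
        rw [← Complex.ofReal_mul, hc2, Complex.ofReal_one]
      rw [form_smul₁, form_smul₂]
      calc ((2 * (1 - θ) : ℝ) : ℂ) * (((c : ℝ) : ℂ) * (((c : ℝ) : ℂ) * Pd.form a b w))
          = (((2 * (1 - θ) : ℝ) : ℂ) * ((c : ℝ) : ℂ)) * (((c : ℝ) : ℂ) * Pd.form a b w) := by ring
        _ = ((c : ℝ) : ℂ) * Pd.form a b w := by rw [hAc, one_mul]
    have hmildG := isMildSolutionFor_smul Pd.form
      (fun a b w => ((2 * (1 - θ) : ℝ) : ℂ) * Pd.form a b w) c hG _ _ _ hu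
    rw [← schwartzL2_smul] at hmildG
    refine ⟨⟨hθ.1, by linarith [hθ.2]⟩, c • u₀, isDivFree_const_smul (u₀.smooth 1) hdiv c, S, hS,
      fun t => ((c : ℝ) : ℂ) • u t, ?_, ?_, ?_⟩
    · -- mild for the segment form of `𝒟` at `θ`: the Euler component is invisible along `c • u`
      refine isMildSolutionFor_of_congr_traj hmildG fun s hs w hw => ?_
      have hus : MemH10df (((c : ℝ) : ℂ) • u s) := (hu.1 s hs).smul c
      have htr' : eulerForm (((c : ℝ) : ℂ) • u s) (((c : ℝ) : ℂ) • u s) w = 0 := by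
        rw [eulerForm_smul_smul, htr s hs w hw, mul_zero]
      beta_reduce
      rw [h𝒟 _ _ _ hus hus hw]
      beta_reduce
      rw [htr']
      push_cast
      ring
    · -- the Type-I rate at ceiling `c · 2(1-θ)K = K`
      intro t ht
      have hcn : ‖((c : ℝ) : ℂ)‖ₑ = ENNReal.ofReal c := by
        rw [← ofReal_norm, Complex.norm_real, Real.norm_eq_abs, abs_of_nonneg hc.le]
      show eLpNorm (((((c : ℝ) : ℂ) • u t : L2C)) : EuclideanSpace ℝ (Fin 3) → EuclideanSpace ℂ (Fin 3))
          ⊤ volume ≤ ENNReal.ofReal (K / Real.sqrt (S - t))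
      rw [eLpNorm_coe_const_smul, hcn]
      calc ENNReal.ofReal c * eLpNorm (u t : EuclideanSpace ℝ (Fin 3) → EuclideanSpace ℂ (Fin 3)) ⊤ volume
          ≤ ENNReal.ofReal c * ENNReal.ofReal (2 * (1 - θ) * K / Real.sqrt (S - t)) :=
            mul_le_mul_right (hrate t ht) _
        _ = ENNReal.ofReal (K / Real.sqrt (S - t)) := by
            rw [← ENNReal.ofReal_mul hc.le, ← mul_div_assoc, hcK]
    · -- no segment-mild extension of `c • u`: it would bound `‖u t‖_{H¹⁰}` on `[0,S)`, and the
      -- pump's `H¹⁰` continuation criterion would then extend `u` itself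
      rintro ⟨S', hSS', v, hv, hvu⟩
      obtain ⟨C, hCb⟩ := exists_H10_bound_of_extension hSS' hv
      have hcin : ‖((c⁻¹ : ℝ) : ℂ)‖ₑ = ENNReal.ofReal |c⁻¹| := by
        rw [← ofReal_norm, Complex.norm_real, Real.norm_eq_abs]
      refine hnoext (stub_thesis_H10Continuation Pd u₀ hdiv S hS u hu ⟨|c⁻¹| * C, fun t ht => ?_⟩)
      have hut : u t = ((c⁻¹ : ℝ) : ℂ) • v t := by
        rw [hvu t ht, inv_smul_smul_ofReal hc0]
      rw [hut, eFourierSobolevNorm_const_smul, hcin, ENNReal.ofReal_mul (abs_nonneg _)]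
      exact mul_le_mul_right (hCb t ht) _
  -- Step 2: `θ = 1/2` is not a member (there the segment form is `B̃_Pd` on `H¹⁰_df`)
  have hhalf : (1 / 2 : ℝ) ∉ btSet[𝒟, K] := by
    have hdiag : ∀ a w : L2C, MemH10df a → MemH10df w →
        ((1 - (1 / 2 : ℝ) : ℝ) : ℂ) * 𝒟.form a a w + (((1 / 2 : ℝ) : ℝ) : ℂ) * eulerForm a a w =
          Pd.form a a w := by
      intro a w ha hw
      rw [h𝒟 a a w ha ha hw]
      beta_reduce
      push_cast
      ring
    rintro ⟨-, u₀, hdiv, S, hS, u, hu, hrate, hnoext⟩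
    refine hnone ⟨u₀, hdiv, S, hS, u,
      (isMildSolutionFor_Ico_congr_memH10df
        (T := fun a b w => ((1 - (1 / 2 : ℝ) : ℝ) : ℂ) * 𝒟.form a b w + (((1 / 2 : ℝ) : ℝ) : ℂ) * eulerForm a b w)
        (T' := Pd.form) hdiag).1 hu, hrate, ?_⟩
    rintro ⟨S', hSS', v, hv, hvu⟩
    exact hnoext ⟨S', hSS', v,
      (isMildSolutionFor_Ico_congr_memH10df
        (T := fun a b w => ((1 - (1 / 2 : ℝ) : ℝ) : ℂ) * 𝒟.form a b w + (((1 / 2 : ℝ) : ℝ) : ℂ) * eulerForm a b w)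
        (T' := Pd.form) hdiag).2 hv, hvu⟩
  -- Step 3: closedness would force `1/2 ∈ S_{𝒟,K}`
  have hmem : (1 / 2 : ℝ) ∈ btSet[𝒟, K] := by
    refine hcl.closure_subset_iff.2 hsub ?_
    rw [closure_Ico (by norm_num : (0 : ℝ) ≠ 1 / 2)]
    exact ⟨by norm_num, le_rfl⟩
  exact hhalf hmem

end Summit.NavierStokesRegularity.NavierStokesRegularity.Cruxes.BoundedTemperatureClosed.StrategistNegation

end
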